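import Summits.AtomisticToContinuum.HydrodynamicLimit.Theses.StiffCollisionalRelaxation

/-!
# `HsFreeEnergyConvex`: transport of the free-energy convexity to conserved variables

Support item stmt-AtomisticToContinuum-9526 (`HsFreeEnergyConvex`, shared verbatim by the routes
`CollisionIsometryCLT` and `StiffCollisionalRelaxation` of `AtomisticToContinuum/HydrodynamicLimit`).
Repair 2026-08-16: route `CollisionIsometryCLT` dropped its copy of the declaration at rev 9 (crux-only
repair), so the constant `Summit.AtomisticToContinuum.HydrodynamicLimit.Theses.CollisionIsometryCLT.HsFreeEnergyConvex`
is re-declared below, with the item's ledger signature verbatim (identical to the surviving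
`StiffCollisionalRelaxation.HsFreeEnergyConvex`), solely so that the landed theorem
`hsFreeEnergyConvex_of_convexOn` keeps its statement and keeps elaborating unchanged (append-only
Theorems; same device as `Theorems/CoherentStatesAssembly2.lean` of AnomalousDissipation); the import of
that route file is dropped (nothing else of it was used).

The item asks that, for every reduced diameter `σ > 0`, minus the hard-sphere entropy density
`F_σ(ρ, m, E) = -ρ (3/2 log(2/3 (E/ρ - |m|²/(2ρ²))) - log ρ - f_ex(ρσ³))`
be convex on the chamber `{0 < ρ, ρσ³ < 11/10, |m|² < 2ρE}` of conserved variables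
(`f_ex = hsExcessFreeEnergy`). This file proves the **perspective (transport) step**:
`F_σ = (3/2) P + G_σ` with
* `P(ρ, m, E) = -ρ log(2/3 (E/ρ - |m|²/(2ρ²)))`, the perspective `ρ φ(m/ρ, E/ρ)` of the convex
  function `φ(m', E') = -log(2/3 (E' - |m'|²/2))` on `{|m'|² < 2E'}` — convex by the two-point
  perspective inequality (`thermal_two_point`: Cauchy–Schwarz for `|m|²/ρ`, concavity and
  monotonicity of `log`);
* `G_σ(ρ) = ρ log ρ + ρ f_ex(ρσ³) = σ⁻³ h(ρσ³) - 3ρ log σ` with the free-energy density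
  `h(η) = η log η + η f_ex(η)` — convex as soon as `h` is convex on `(0, 11/10)`
  (`idealExcess_two_point`).
Hence `hsFreeEnergyConvex_of_convexOn`: convexity of `h` on `(0, 11/10)` (Ruelle's convexity of
the configurational free-energy density below close packing, for the tree's object
`hsExcessFreeEnergy`) implies the item, for both route decls.

References: D. Ruelle, *Statistical Mechanics: Rigorous Results* (1969), Thm 3.4.4;
C. Dafermos, *Hyperbolic Conservation Laws in Continuum Physics* (2005), §5.2 (entropy in
conserved variables).
-/

namespace Summit.AtomisticToContinuum.HydrodynamicLimit.Theses.CollisionIsometryCLT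

/-- Item stmt-AtomisticToContinuum-9526 (`HsFreeEnergyConvex`) as route `CollisionIsometryCLT` declared
it until its rev 9 (2026-08-16), ledger signature verbatim: for every `σ > 0`, minus the hard-sphere
entropy density `-(ρ (3/2 log(2/3 (E/ρ - |m|²/(2ρ²))) - log ρ - f_ex(ρσ³)))` is convex on the chamber
`{0 < ρ, ρσ³ < 11/10, |m|² < 2ρE}` of conserved variables. Re-declared here (a definition, not a cited
fact) only to keep the landed transport theorem below elaborating under its original statement; it is
the same proposition as `StiffCollisionalRelaxation.HsFreeEnergyConvex`. -/
def HsFreeEnergyConvex : Prop :=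
  ∀ σ : ℝ, 0 < σ → ConvexOn ℝ {U : ℝ × (EuclideanSpace ℝ (Fin 3)) × ℝ | 0 < U.1 ∧ U.1 * σ ^ 3 < 11 / 10 ∧ ‖U.2.1‖ ^ 2 < 2 * U.1 * U.2.2} (fun U : ℝ × (EuclideanSpace ℝ (Fin 3)) × ℝ => -(U.1 * (3 / 2 * Real.log (2 / 3 * (U.2.2 / U.1 - ‖U.2.1‖ ^ 2 / (2 * U.1 ^ 2))) - Real.log U.1 - Literature.MathematicalPhysics.KineticTheory.hsExcessFreeEnergy (U.1 * σ ^ 3))))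

end Summit.AtomisticToContinuum.HydrodynamicLimit.Theses.CollisionIsometryCLT

namespace Summit.AtomisticToContinuum.HydrodynamicLimit.Theorems

open Real Set

namespace HsFreeEnergyConvex

/-- **Cauchy–Schwarz for the perspective of `|·|²`** (polynomial form): for `ρ₁, ρ₂ > 0` and
`a, b ≥ 0`, `|a m₁ + b m₂|² ρ₁ ρ₂ ≤ (aρ₁ + bρ₂)(a|m₁|²ρ₂ + b|m₂|²ρ₁)`, i.e.
`|m|²/ρ ≤ a|m₁|²/ρ₁ + b|m₂|²/ρ₂` along convex combinations. [folklore] -/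
theorem norm_sq_combo_mul_le {V : Type*} [NormedAddCommGroup V] [NormedSpace ℝ V]
    {ρ₁ ρ₂ a b : ℝ} (h₁ : 0 < ρ₁) (h₂ : 0 < ρ₂) (ha : 0 ≤ a) (hb : 0 ≤ b) (m₁ m₂ : V) :
    ‖a • m₁ + b • m₂‖ ^ 2 * (ρ₁ * ρ₂) ≤
      (a * ρ₁ + b * ρ₂) * (a * ‖m₁‖ ^ 2 * ρ₂ + b * ‖m₂‖ ^ 2 * ρ₁) := by
  have hn : ‖a • m₁ + b • m₂‖ ≤ a * ‖m₁‖ + b * ‖m₂‖ := by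
    calc ‖a • m₁ + b • m₂‖ ≤ ‖a • m₁‖ + ‖b • m₂‖ := norm_add_le _ _
      _ = a * ‖m₁‖ + b * ‖m₂‖ := by
        rw [norm_smul, norm_smul, Real.norm_of_nonneg ha, Real.norm_of_nonneg hb]
  have h1 : ‖a • m₁ + b • m₂‖ ^ 2 ≤ (a * ‖m₁‖ + b * ‖m₂‖) ^ 2 :=
    pow_le_pow_left₀ (norm_nonneg _) hn 2
  have key : (a * ‖m₁‖ + b * ‖m₂‖) ^ 2 * (ρ₁ * ρ₂) ≤
      (a * ρ₁ + b * ρ₂) * (a * ‖m₁‖ ^ 2 * ρ₂ + b * ‖m₂‖ ^ 2 * ρ₁) := by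
    have := mul_nonneg (mul_nonneg ha hb) (sq_nonneg (‖m₁‖ * ρ₂ - ‖m₂‖ * ρ₁))
    nlinarith [this]
  exact (mul_le_mul_of_nonneg_right h1 (by positivity)).trans key

/-- **The two-point perspective inequality for the thermal part.** For states
`(ρᵢ, mᵢ, Eᵢ)` in the chamber `{0 < ρ, |m|² < 2ρE}` and weights `a, b > 0` (not necessarily
summing to `1`: everything is homogeneous), the combination `(ρ, m, E)` lies in the chamber and
`-ρ log(2/3 (E/ρ - |m|²/(2ρ²))) ≤ a (-ρ₁ log(…₁)) + b (-ρ₂ log(…₂))`: the map is the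
perspective `ρ φ(m/ρ, E/ρ)` of the convex `φ(m', E') = -log(2/3 (E' - |m'|²/2))`, and with the
weights `wᵢ = a ρᵢ/ρ` one has `ρ Θ ≥ aρ₁Θ₁ + bρ₂Θ₂ = ρ (w₁Θ₁ + w₂Θ₂)` (Cauchy–Schwarz,
`norm_sq_combo_mul_le`) and `w₁ log Θ₁ + w₂ log Θ₂ ≤ log (w₁Θ₁ + w₂Θ₂) ≤ log Θ`.
[cite: Dafermos2005, §5.2] -/
theorem thermal_two_point {V : Type*} [NormedAddCommGroup V] [NormedSpace ℝ V]
    {ρ₁ ρ₂ E₁ E₂ a b : ℝ} {m₁ m₂ : V} (h₁ : 0 < ρ₁) (h₂ : 0 < ρ₂)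
    (hE₁ : ‖m₁‖ ^ 2 < 2 * ρ₁ * E₁) (hE₂ : ‖m₂‖ ^ 2 < 2 * ρ₂ * E₂)
    (ha : 0 < a) (hb : 0 < b) :
    ‖a • m₁ + b • m₂‖ ^ 2 < 2 * (a * ρ₁ + b * ρ₂) * (a * E₁ + b * E₂) ∧
    -((a * ρ₁ + b * ρ₂) * Real.log (2 / 3 * ((a * E₁ + b * E₂) / (a * ρ₁ + b * ρ₂) -
        ‖a • m₁ + b • m₂‖ ^ 2 / (2 * (a * ρ₁ + b * ρ₂) ^ 2)))) ≤
      a * -(ρ₁ * Real.log (2 / 3 * (E₁ / ρ₁ - ‖m₁‖ ^ 2 / (2 * ρ₁ ^ 2)))) +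
        b * -(ρ₂ * Real.log (2 / 3 * (E₂ / ρ₂ - ‖m₂‖ ^ 2 / (2 * ρ₂ ^ 2)))) := by
  set ρ : ℝ := a * ρ₁ + b * ρ₂ with hρ_def
  set E : ℝ := a * E₁ + b * E₂ with hE_def
  set m : V := a • m₁ + b • m₂ with hm_def
  have hρ : 0 < ρ := by positivity
  have h12 : 0 < ρ₁ * ρ₂ := mul_pos h₁ h₂
  -- Cauchy–Schwarz
  have hT : ‖m‖ ^ 2 * (ρ₁ * ρ₂) ≤ ρ * (a * ‖m₁‖ ^ 2 * ρ₂ + b * ‖m₂‖ ^ 2 * ρ₁) :=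
    norm_sq_combo_mul_le h₁ h₂ ha.le hb.le m₁ m₂
  -- the chamber is convex
  have hdom : ‖m‖ ^ 2 < 2 * ρ * E := by
    have hlt : a * ‖m₁‖ ^ 2 * ρ₂ + b * ‖m₂‖ ^ 2 * ρ₁ < 2 * E * (ρ₁ * ρ₂) := by
      have e : 2 * E * (ρ₁ * ρ₂) = a * (2 * ρ₁ * E₁) * ρ₂ + b * (2 * ρ₂ * E₂) * ρ₁ := by
        rw [hE_def]; ring
      rw [e]
      gcongr
    have h' : ‖m‖ ^ 2 * (ρ₁ * ρ₂) < 2 * ρ * E * (ρ₁ * ρ₂) := by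
      calc ‖m‖ ^ 2 * (ρ₁ * ρ₂) ≤ ρ * (a * ‖m₁‖ ^ 2 * ρ₂ + b * ‖m₂‖ ^ 2 * ρ₁) := hT
        _ < ρ * (2 * E * (ρ₁ * ρ₂)) := mul_lt_mul_of_pos_left hlt hρ
        _ = 2 * ρ * E * (ρ₁ * ρ₂) := by ring
    exact lt_of_mul_lt_mul_right h' h12.le
  refine ⟨hdom, ?_⟩
  -- the reduced temperatures
  set Θ₁ : ℝ := 2 / 3 * (E₁ / ρ₁ - ‖m₁‖ ^ 2 / (2 * ρ₁ ^ 2)) with hΘ₁_def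
  set Θ₂ : ℝ := 2 / 3 * (E₂ / ρ₂ - ‖m₂‖ ^ 2 / (2 * ρ₂ ^ 2)) with hΘ₂_def
  set Θ : ℝ := 2 / 3 * (E / ρ - ‖m‖ ^ 2 / (2 * ρ ^ 2)) with hΘ_def
  have hρΘ₁ : ρ₁ * Θ₁ = 2 / 3 * (E₁ - ‖m₁‖ ^ 2 / (2 * ρ₁)) := by
    rw [hΘ₁_def]; field_simp
  have hρΘ₂ : ρ₂ * Θ₂ = 2 / 3 * (E₂ - ‖m₂‖ ^ 2 / (2 * ρ₂)) := by
    rw [hΘ₂_def]; field_simp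
  have hρΘ : ρ * Θ = 2 / 3 * (E - ‖m‖ ^ 2 / (2 * ρ)) := by
    rw [hΘ_def]; field_simp
  have hΘ₁ : 0 < Θ₁ := by
    have hs : 0 < E₁ - ‖m₁‖ ^ 2 / (2 * ρ₁) := by
      rw [sub_pos, div_lt_iff₀ (by positivity)]; linarith
    have h' : 0 < ρ₁ * Θ₁ := by rw [hρΘ₁]; exact mul_pos (by norm_num) hs
    exact (mul_pos_iff_of_pos_left h₁).1 h'
  have hΘ₂ : 0 < Θ₂ := by
    have hs : 0 < E₂ - ‖m₂‖ ^ 2 / (2 * ρ₂) := by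
      rw [sub_pos, div_lt_iff₀ (by positivity)]; linarith
    have h' : 0 < ρ₂ * Θ₂ := by rw [hρΘ₂]; exact mul_pos (by norm_num) hs
    exact (mul_pos_iff_of_pos_left h₂).1 h'
  -- `a ρ₁ Θ₁ + b ρ₂ Θ₂ ≤ ρ Θ`
  have hkey : a * (ρ₁ * Θ₁) + b * (ρ₂ * Θ₂) ≤ ρ * Θ := by
    rw [hρΘ₁, hρΘ₂, hρΘ]
    have hq : ‖m‖ ^ 2 / (2 * ρ) ≤ a * (‖m₁‖ ^ 2 / (2 * ρ₁)) + b * (‖m₂‖ ^ 2 / (2 * ρ₂)) := by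
      have h2ρ : (0 : ℝ) < 2 * ρ := by positivity
      have h2ρ₁ : (0 : ℝ) < 2 * ρ₁ := by positivity
      have h2ρ₂ : (0 : ℝ) < 2 * ρ₂ := by positivity
      rw [← mul_div_assoc, ← mul_div_assoc, div_add_div _ _ h2ρ₁.ne' h2ρ₂.ne',
        div_le_div_iff₀ h2ρ (mul_pos h2ρ₁ h2ρ₂)]
      linear_combination 4 * hT
    have eE : E = a * E₁ + b * E₂ := hE_def
    linarith [hq, eE]
  -- weights
  set w₁ : ℝ := a * ρ₁ / ρ with hw₁_def
  set w₂ : ℝ := b * ρ₂ / ρ with hw₂_def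
  have hw₁' : 0 < w₁ := by rw [hw₁_def]; positivity
  have hw₁ : 0 ≤ w₁ := hw₁'.le
  have hw₂ : 0 ≤ w₂ := by rw [hw₂_def]; positivity
  have hw : w₁ + w₂ = 1 := by
    rw [hw₁_def, hw₂_def, ← add_div, div_eq_one_iff_eq hρ.ne']
  have hwΘ : 0 < w₁ * Θ₁ + w₂ * Θ₂ :=
    add_pos_of_pos_of_nonneg (mul_pos hw₁' hΘ₁) (mul_nonneg hw₂ hΘ₂.le)
  have hwΘ_le : w₁ * Θ₁ + w₂ * Θ₂ ≤ Θ := by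
    have e : w₁ * Θ₁ + w₂ * Θ₂ = (a * (ρ₁ * Θ₁) + b * (ρ₂ * Θ₂)) / ρ := by
      rw [hw₁_def, hw₂_def]; field_simp
    rw [e, div_le_iff₀ hρ]
    linarith [hkey]
  have hΘ : 0 < Θ := hwΘ.trans_le hwΘ_le
  -- concavity and monotonicity of `log`
  have hJ : w₁ * Real.log Θ₁ + w₂ * Real.log Θ₂ ≤ Real.log (w₁ * Θ₁ + w₂ * Θ₂) := by
    have h := strictConcaveOn_log_Ioi.concaveOn.2 (mem_Ioi.2 hΘ₁) (mem_Ioi.2 hΘ₂) hw₁ hw₂ hw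
    simpa only [smul_eq_mul] using h
  have hmono : Real.log (w₁ * Θ₁ + w₂ * Θ₂) ≤ Real.log Θ := Real.log_le_log hwΘ hwΘ_le
  have hfin : a * (ρ₁ * Real.log Θ₁) + b * (ρ₂ * Real.log Θ₂) ≤ ρ * Real.log Θ := by
    have e : a * (ρ₁ * Real.log Θ₁) + b * (ρ₂ * Real.log Θ₂) =
        ρ * (w₁ * Real.log Θ₁ + w₂ * Real.log Θ₂) := by
      rw [hw₁_def, hw₂_def]; field_simp
    rw [e]
    exact mul_le_mul_of_nonneg_left (hJ.trans hmono) hρ.le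
  linarith [hfin]

/-- **The two-point inequality for the ideal + excess part.** If the free-energy density
`h(η) = η log η + η f(η)` is convex on `(0, 11/10)`, then for every `σ > 0` the map
`ρ ↦ ρ log ρ + ρ f(ρσ³) = σ⁻³ h(ρσ³) - 3ρ log σ` is convex on `{0 < ρ, ρσ³ < 11/10}` (two-point
form). [cite: Ruelle1969, Thm 3.4.4] -/
theorem idealExcess_two_point {f : ℝ → ℝ}
    (hh : ConvexOn ℝ (Ioo (0 : ℝ) (11 / 10)) (fun η : ℝ => η * Real.log η + η * f η))
    {σ ρ₁ ρ₂ a b : ℝ} (hσ : 0 < σ) (h₁ : 0 < ρ₁) (h₁' : ρ₁ * σ ^ 3 < 11 / 10) (h₂ : 0 < ρ₂)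
    (h₂' : ρ₂ * σ ^ 3 < 11 / 10) (ha : 0 < a) (hb : 0 < b) (hab : a + b = 1) :
    (a * ρ₁ + b * ρ₂) * Real.log (a * ρ₁ + b * ρ₂) +
        (a * ρ₁ + b * ρ₂) * f ((a * ρ₁ + b * ρ₂) * σ ^ 3) ≤
      a * (ρ₁ * Real.log ρ₁ + ρ₁ * f (ρ₁ * σ ^ 3)) +
        b * (ρ₂ * Real.log ρ₂ + ρ₂ * f (ρ₂ * σ ^ 3)) := by
  have hσ3 : 0 < σ ^ 3 := by positivity
  -- `ρ log ρ + ρ f(ρσ³) = σ⁻³ h(ρσ³) - 3 ρ log σ`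
  have iden : ∀ ρ : ℝ, 0 < ρ → ρ * Real.log ρ + ρ * f (ρ * σ ^ 3) =
      (σ ^ 3)⁻¹ * (ρ * σ ^ 3 * Real.log (ρ * σ ^ 3) + ρ * σ ^ 3 * f (ρ * σ ^ 3)) -
        3 * Real.log σ * ρ := by
    intro ρ hρ
    rw [Real.log_mul hρ.ne' hσ3.ne', Real.log_pow]
    have hu : (σ ^ 3)⁻¹ * σ ^ 3 = 1 := inv_mul_cancel₀ hσ3.ne'
    linear_combination -(ρ * Real.log ρ + ρ * f (ρ * σ ^ 3) + 3 * ρ * Real.log σ) * hu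
  have hmem : ∀ ρ : ℝ, 0 < ρ → ρ * σ ^ 3 < 11 / 10 → ρ * σ ^ 3 ∈ Ioo (0 : ℝ) (11 / 10) :=
    fun ρ hρ hρ' => ⟨by positivity, hρ'⟩
  have hc := hh.2 (hmem ρ₁ h₁ h₁') (hmem ρ₂ h₂ h₂') ha.le hb.le hab
  simp only [smul_eq_mul] at hc
  have e : a * (ρ₁ * σ ^ 3) + b * (ρ₂ * σ ^ 3) = (a * ρ₁ + b * ρ₂) * σ ^ 3 := by ring
  rw [e] at hc
  have hρ : 0 < a * ρ₁ + b * ρ₂ := by positivity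
  rw [iden _ hρ, iden _ h₁, iden _ h₂]
  have hinv : 0 < (σ ^ 3)⁻¹ := inv_pos.2 hσ3
  linarith [mul_le_mul_of_nonneg_left hc hinv.le]

/-- **Transport lemma** (perspective step of item stmt-AtomisticToContinuum-9526): if the
hard-sphere free-energy density `η ↦ η log η + η f_ex(η)` (`f_ex = hsExcessFreeEnergy`) is convex on
`(0, 11/10)`, then for every `σ > 0` minus the entropy density
`-(ρ (3/2 log(2/3 (E/ρ - |m|²/(2ρ²))) - log ρ - f_ex(ρσ³)))` is convex on the chamber
`{0 < ρ, ρσ³ < 11/10, |m|² < 2ρE}` — the route decl `CollisionIsometryCLT.HsFreeEnergyConvex`.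
[cite: Dafermos2005, §5.2] -/
theorem hsFreeEnergyConvex_of_convexOn
    (hh : ConvexOn ℝ (Ioo (0 : ℝ) (11 / 10)) (fun η : ℝ => η * Real.log η +
      η * Literature.MathematicalPhysics.KineticTheory.hsExcessFreeEnergy η)) :
    Summit.AtomisticToContinuum.HydrodynamicLimit.Theses.CollisionIsometryCLT.HsFreeEnergyConvex := by
  intro σ hσ
  refine convexOn_iff_forall_pos.2 ⟨?_, ?_⟩
  · refine convex_iff_forall_pos.2 ?_
    rintro U₁ ⟨hρ₁, hσ₁, hm₁⟩ U₂ ⟨hρ₂, hσ₂, hm₂⟩ a b ha hb hab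
    refine ⟨?_, ?_, ?_⟩
    · simp only [Prod.fst_add, Prod.smul_fst, smul_eq_mul]
      positivity
    · simp only [Prod.fst_add, Prod.smul_fst, smul_eq_mul]
      calc (a * U₁.1 + b * U₂.1) * σ ^ 3 = a * (U₁.1 * σ ^ 3) + b * (U₂.1 * σ ^ 3) := by ring
        _ < a * (11 / 10) + b * (11 / 10) := by gcongr
        _ = 11 / 10 := by linarith [hab]
    · simp only [Prod.fst_add, Prod.smul_fst, Prod.snd_add, Prod.smul_snd, smul_eq_mul]
      exact (thermal_two_point hρ₁ hρ₂ hm₁ hm₂ ha hb).1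
  · rintro U₁ ⟨hρ₁, hσ₁, hm₁⟩ U₂ ⟨hρ₂, hσ₂, hm₂⟩ a b ha hb hab
    simp only [Prod.fst_add, Prod.smul_fst, Prod.snd_add, Prod.smul_snd, smul_eq_mul]
    have hT := (thermal_two_point hρ₁ hρ₂ hm₁ hm₂ ha hb).2
    have hG := idealExcess_two_point hh hσ hρ₁ hσ₁ hρ₂ hσ₂ ha hb hab
    have e : ∀ ρ L x y : ℝ, -(ρ * (3 / 2 * L - x - y)) = 3 / 2 * -(ρ * L) + (ρ * x + ρ * y) := by
      intros; ring
    rw [e, e, e]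
    linarith [hT, hG]

/-- The same transport lemma for the verbatim-identical decl of route `StiffCollisionalRelaxation`
(item stmt-AtomisticToContinuum-9526 is shared by both routes). [cite: Dafermos2005, §5.2] -/
theorem hsFreeEnergyConvex_of_convexOn'
    (hh : ConvexOn ℝ (Ioo (0 : ℝ) (11 / 10)) (fun η : ℝ => η * Real.log η +
      η * Literature.MathematicalPhysics.KineticTheory.hsExcessFreeEnergy η)) :
    Summit.AtomisticToContinuum.HydrodynamicLimit.Theses.StiffCollisionalRelaxation.HsFreeEnergyConvex :=
  hsFreeEnergyConvex_of_convexOn hh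

end HsFreeEnergyConvex

end Summit.AtomisticToContinuum.HydrodynamicLimit.Theorems
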